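import Summits.CriticalPhenomena.PercolationContinuityZ3.Theorems.FK.NewmanCLTBlocks
import Summits.CriticalPhenomena.PercolationContinuityZ3.Theorems.FK.CovarianceBoxSums
import Mathlib.MeasureTheory.Measure.LevyConvergence
import Mathlib.MeasureTheory.Function.ConvergenceInDistribution
import Mathlib.Probability.Distributions.Gaussian.Real
import Literature.NumberTheory.LFunctions.XiHeatRayGaussian
import HarnessLib

/-!
# NEWMAN'S CENTRAL LIMIT THEOREM (Newman 1980, Thm. 2) FOR POSITIVELY ASSOCIATED BOUNDED INCREASING LATTICE FIELDS WITH
# SUMMABLE TRANSLATION-COVARIANT COVARIANCES: `(S_n − E S_n)/√|Λ_n| ⇒ N(0, Σ_z γ(z))`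

Claimed R42 (8)(c) in the cell INBOX at 2026-08-28T13:11:28Z by fkp-10a gen 354 (NEW CLAIM #1 of the gen), under provision (ι) (no coordinator seated since gen 272's closing line l.8385: the lane lead absorbs the registry word, silence = consent; readers fk-ref / fkt-lead / fkp-18r / fkp-10b); lineage row FO-10a-g354 (self-suggested), package g354-newmanclt, label NC-D.
Helper file of the `fk-continuity` build cell (bschramm lane; `--supports stmt-CriticalPhenomena-4575`); builds on
p205010 (kernel theorem, internal audit signed; external expert review pending). No definitions, no named facts, no
sorries; standard axioms. UNCONDITIONAL. GENERIC: `μ` a positively associated (FKG) probability measure on a preordered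
measurable space `Ω` (tree: `IsPositivelyAssociated`), `X : Site d → Ω → ℝ` (`d ≥ 1`) increasing, measurable, `|X_z| ≤ M`,
with covariances `Cov(X_x, X_y) = γ(y − x)` (translation covariance of second moments — Newman's (B) is only used
through this) and `Σ_z γ(z) < ∞` (Newman's (D), finite susceptibility; `γ ≥ 0` by FKG). With `S_n = Σ_{z∈Λ_n} X_z`,
`Λ_n = [-n,n]^d`, `σ² = Σ_z γ(z)`:

* `norm_charFun_boxSum_sub_le` — the quantitative finite-`n` estimate behind Thm. 2 (blocks of side `2k+1`):
  `‖E e^{it(S_n − ES_n)/√|Λ_n|} − e^{−σ²t²/2}‖ ≤ 2t²Δ + t²(|s|K³ + s²K⁴) + (t²/2)(|a(n) − σ²| + Δ)`,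
  `a(L) = |Λ_L|⁻¹Σ_{x,y∈Λ_L}γ(y−x)`, `Δ = a(n) − |Λ_m||Λ_k| a(k)/|Λ_n|`, `s = t/√|Λ_n|`, `K = 2M|Λ_k|`, `m = ⌊(n−k)/(2k+1)⌋`.
* `tendsto_charFun_boxSum` — **THM. 2, characteristic-function form** (the elementary `|e^{−a} − e^{−b}| ≤ |a − b|` is
  the tree's `Literature.NumberTheory.LFunctions.abs_exp_neg_sub_exp_neg_le`): for every `t`,
  `E exp(it (S_n − E S_n)/√|Λ_n|) → exp(−σ² t²/2)`.
* `tendstoInDistribution_boxSum` — **THM. 2**: `(S_n − E S_n)/√|Λ_n| → N(0, σ²)` in distribution (Mathlib's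
  `TendstoInDistribution`, via Lévy's continuity theorem `ProbabilityMeasure.tendsto_iff_tendsto_charFun`).

Newman states Thm. 2 for the block variables of a stationary FKG field with finite variances (joint convergence of
finitely many blocks); this file proves the one-block statement along the boxes `Λ_n` for bounded fields (the case of
the random-cluster / Ising applications), with the i.i.d. CLT replaced by the uniform second-order expansion
(`CharFunSecondOrder`), so only second-moment stationarity is needed.

## References

* C. M. Newman, *Normal fluctuations and the FKG inequalities*, Comm. Math. Phys. 74 (1980) 119–128, Thm. 2 and its
  proof. [Newman1980]
* G. Grimmett, *The Random-Cluster Model*, Springer 2006, §4.3 Thm. (4.17)(b), (4.19)(b) (the FK box limits satisfy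
  the hypotheses below `p_c(q)`, companion file `FKEdgeCountCLT.lean`). [Grimmett2006]
-/

noncomputable section

namespace Summit.CriticalPhenomena.PercolationContinuityZ3.Theorems.FK

namespace NewmanCLT

open MeasureTheory ProbabilityTheory Complex Finset Filter Topology
open Literature.Probability.Percolation Literature.Probability.LatticeModels

variable {Ω : Type*} [MeasurableSpace Ω] [Preorder Ω] {μ : Measure Ω} [IsProbabilityMeasure μ] {d : ℕ}
  {X : Site d → Ω → ℝ} {M : ℝ} {γ : Site d → ℝ}

/-! ### The full blocks carry `|Λ_m| · V_k` of the within-block variance -/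

/-- **Lower bound on the within-block variance**: with the block map `β_k` and `m = ⌊(n−k)/(2k+1)⌋`,
`|Λ_m| · Σ_{x,y∈Λ_k} γ(y−x) ≤ Σ_{u∈β_k(Λ_n)} Σ_{x,y ∈ Λ_n ∩ β_k⁻¹u} γ(y−x)` (keep only the full blocks `(2k+1)u + Λ_k`,
`u ∈ Λ_m`, each contributing `V_k` by translation covariance). [cite: Newman1980, proof of Thm. 2] -/
theorem card_mul_sum_le_sum_covSum_blocks [DecidableEq (Site d)] (hμ : IsPositivelyAssociated μ)
    (hXm : ∀ z, Measurable (X z)) (hXmono : ∀ z, Monotone (X z)) (hXb : ∀ z ω, |X z ω| ≤ M)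
    (hcov : ∀ x y, cov[X x, X y; μ] = γ (y - x)) {k n : ℕ} (hkn : k ≤ n) {β : Site d → Site d}
    (hβ : ∀ z i, β z i = (z i + k) / (2 * k + 1)) :
    (#(box d ((n - k) / (2 * k + 1))) : ℝ) * ∑ x ∈ box d k, ∑ y ∈ box d k, γ (y - x) ≤
      ∑ u ∈ (box d n).image β, ∑ x ∈ (box d n).filter (fun z => β z = u),
        ∑ y ∈ (box d n).filter (fun z => β z = u), γ (y - x) := by
  have hkm := blockCount_spec hkn
  set m := (n - k) / (2 * k + 1) with hm
  calc (#(box d m) : ℝ) * ∑ x ∈ box d k, ∑ y ∈ box d k, γ (y - x)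
      = ∑ u ∈ box d m, ∑ x ∈ box d k, ∑ y ∈ box d k, γ (y - x) := by rw [Finset.sum_const, nsmul_eq_mul]
    _ = ∑ u ∈ box d m, ∑ x ∈ (box d n).filter (fun z => β z = u),
          ∑ y ∈ (box d n).filter (fun z => β z = u), γ (y - x) := by
        refine Finset.sum_congr rfl fun u hu => ?_
        rw [filter_blockLabel_eq_image hβ hkm hu, sum_sum_image_add_eq γ (fun i => (2 * k + 1 : ℤ) * u i) k]
    _ ≤ _ := Finset.sum_le_sum_of_subset_of_nonneg (box_subset_image_blockLabel hβ hkm) fun u _ _ =>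
        sum_sum_kernel_nonneg hμ hXm hXmono hXb hcov _ _

/-! ### The quantitative estimate along boxes -/

/-- **Newman's CLT, quantitative finite-`n` form along boxes.** For `k ≤ n` and `s = t/√|Λ_n|` with `s²K² ≤ 2`,
`K = 2M|Λ_k|`: `‖E e^{is(S_n − E S_n)} − e^{−σ²t²/2}‖ ≤ 2t²Δ + t²(|s|K³ + s²K⁴) + (t²/2)(|V_n/|Λ_n| − σ²| + Δ)` where
`V_L = Σ_{x,y∈Λ_L} γ(y−x)`, `Δ = V_n/|Λ_n| − |Λ_m| V_k/|Λ_n|`, `m = ⌊(n−k)/(2k+1)⌋`, `σ² = Σ_z γ(z)`.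
[cite: Newman1980, Thm. 1 (11) and proof of Thm. 2] -/
theorem norm_charFun_boxSum_sub_le (hμ : IsPositivelyAssociated μ) (hXm : ∀ z, Measurable (X z))
    (hXmono : ∀ z, Monotone (X z)) (hM : 0 ≤ M) (hXb : ∀ z ω, |X z ω| ≤ M) (hcov : ∀ x y, cov[X x, X y; μ] = γ (y - x))
    {k n : ℕ} (hkn : k ≤ n) (t : ℝ) (hs : (t / Real.sqrt #(box d n)) ^ 2 * (2 * M * #(box d k)) ^ 2 ≤ 2) :
    ‖∫ ω, cexp ((((t / Real.sqrt #(box d n)) * (∑ z ∈ box d n, X z ω - ∫ ω', ∑ z ∈ box d n, X z ω' ∂μ) : ℝ) : ℂ) * I) ∂μ -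
        ((Real.exp (-((∑' z, γ z) * t ^ 2 / 2)) : ℝ) : ℂ)‖ ≤
      2 * t ^ 2 * ((∑ x ∈ box d n, ∑ y ∈ box d n, γ (y - x)) / #(box d n) -
          #(box d ((n - k) / (2 * k + 1))) * (∑ x ∈ box d k, ∑ y ∈ box d k, γ (y - x)) / #(box d n)) +
        t ^ 2 * (|t / Real.sqrt #(box d n)| * (2 * M * #(box d k)) ^ 3 +
          (t / Real.sqrt #(box d n)) ^ 2 * (2 * M * #(box d k)) ^ 4) +
        t ^ 2 / 2 * (|(∑ x ∈ box d n, ∑ y ∈ box d n, γ (y - x)) / #(box d n) - ∑' z, γ z| +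
          ((∑ x ∈ box d n, ∑ y ∈ box d n, γ (y - x)) / #(box d n) -
            #(box d ((n - k) / (2 * k + 1))) * (∑ x ∈ box d k, ∑ y ∈ box d k, γ (y - x)) / #(box d n))) := by
  classical
  -- names
  set N : ℝ := (#(box d n) : ℝ) with hN
  set s : ℝ := t / Real.sqrt N with hsdef
  set K : ℝ := 2 * M * #(box d k) with hK
  set β : Site d → Site d := fun z i => (z i + k) / (2 * k + 1) with hβdef
  have hβ : ∀ z i, β z i = (z i + k) / (2 * k + 1) := fun z i => rfl
  set V : ℝ := ∑ x ∈ box d n, ∑ y ∈ box d n, γ (y - x) with hV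
  set Vk : ℝ := ∑ x ∈ box d k, ∑ y ∈ box d k, γ (y - x) with hVk
  set W : ℝ := ∑ u ∈ (box d n).image β, ∑ x ∈ (box d n).filter (fun z => β z = u),
    ∑ y ∈ (box d n).filter (fun z => β z = u), γ (y - x) with hW
  set σ2 : ℝ := ∑' z, γ z with hσ2
  have hNpos : 0 < N := card_box_pos d n
  have hsqN : Real.sqrt N ^ 2 = N := Real.sq_sqrt hNpos.le
  have hs2 : s ^ 2 = t ^ 2 / N := by rw [hsdef, div_pow, hsqN]
  have hγ0 : ∀ z, 0 ≤ γ z := covariance_kernel_nonneg hμ hXm hXmono hXb hcov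
  have hσ0 : 0 ≤ σ2 := tsum_nonneg hγ0
  -- the block estimate
  have hB := norm_integral_cexp_blockSum_sub_exp_le hμ hXm hXmono hM hXb hcov (box d n) β
    (κ := #(box d k)) (card_filter_blockLabel_le hβ (box d n)) (s := s) hs
  -- `|Λ_m| V_k ≤ W ≤ V`, `#blocks ≤ N`
  have hWlow : (#(box d ((n - k) / (2 * k + 1))) : ℝ) * Vk ≤ W :=
    card_mul_sum_le_sum_covSum_blocks hμ hXm hXmono hXb hcov hkn hβ
  have hWV : W ≤ V := sum_covSum_blocks_le hμ hXm hXmono hXb hcov (box d n) β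
  have hW0 : 0 ≤ W := le_trans (mul_nonneg (Nat.cast_nonneg _) (sum_sum_kernel_nonneg hμ hXm hXmono hXb hcov _ _)) hWlow
  have hU : (#((box d n).image β) : ℝ) ≤ N := by rw [hN]; exact_mod_cast card_image_le
  -- the Gaussian comparison `|e^{−s²W/2} − e^{−σ²t²/2}| ≤ (t²/2)|W/N − σ²|`
  have hG : ‖((Real.exp (-(s ^ 2 * W / 2)) : ℝ) : ℂ) - ((Real.exp (-(σ2 * t ^ 2 / 2)) : ℝ) : ℂ)‖ ≤
      t ^ 2 / 2 * (|V / N - σ2| + (V / N - #(box d ((n - k) / (2 * k + 1))) * Vk / N)) := by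
    rw [← Complex.ofReal_sub, Complex.norm_real, Real.norm_eq_abs]
    refine (Literature.NumberTheory.LFunctions.abs_exp_neg_sub_exp_neg_le (div_nonneg (mul_nonneg (sq_nonneg _) hW0) (by norm_num))
      (div_nonneg (mul_nonneg hσ0 (sq_nonneg _)) (by norm_num))).trans ?_
    rw [hs2, show t ^ 2 / N * W / 2 - σ2 * t ^ 2 / 2 = t ^ 2 / 2 * (W / N - σ2) by ring, abs_mul,
      abs_of_nonneg (by positivity : (0 : ℝ) ≤ t ^ 2 / 2)]
    refine mul_le_mul_of_nonneg_left ?_ (by positivity)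
    have h1 : |W / N - σ2| ≤ |W / N - V / N| + |V / N - σ2| := abs_sub_le _ _ _
    have h2 : |W / N - V / N| = V / N - W / N := by
      rw [abs_sub_comm, abs_of_nonneg (sub_nonneg.2 (div_le_div_of_nonneg_right hWV hNpos.le))]
    have h3 : V / N - W / N ≤ V / N - #(box d ((n - k) / (2 * k + 1))) * Vk / N := by
      have := div_le_div_of_nonneg_right hWlow hNpos.le
      linarith
    linarith
  -- assemble
  have hterm1 : 2 * s ^ 2 * (V - W) ≤ 2 * t ^ 2 * (V / N - #(box d ((n - k) / (2 * k + 1))) * Vk / N) := by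
    rw [hs2, show 2 * (t ^ 2 / N) * (V - W) = 2 * t ^ 2 * (V / N - W / N) by ring]
    refine mul_le_mul_of_nonneg_left ?_ (by positivity)
    have := div_le_div_of_nonneg_right hWlow hNpos.le
    rw [mul_div_assoc] at this ⊢
    linarith
  have hterm2 : (#((box d n).image β) : ℝ) * (|s| ^ 3 * K ^ 3 + s ^ 4 * K ^ 4) ≤ t ^ 2 * (|s| * K ^ 3 + s ^ 2 * K ^ 4) := by
    have e : t ^ 2 * (|s| * K ^ 3 + s ^ 2 * K ^ 4) = N * (|s| ^ 3 * K ^ 3 + s ^ 4 * K ^ 4) := by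
      have habs : |s| ^ 3 = s ^ 2 * |s| := by
        rw [pow_succ, sq_abs]
      rw [habs, show s ^ 4 = s ^ 2 * s ^ 2 by ring, hs2]
      field_simp
    rw [e]
    have hK0 : 0 ≤ K := mul_nonneg (mul_nonneg (by norm_num) hM) (Nat.cast_nonneg _)
    exact mul_le_mul_of_nonneg_right hU (add_nonneg (mul_nonneg (pow_nonneg (abs_nonneg _) 3) (pow_nonneg hK0 3))
      (mul_nonneg (by positivity) (pow_nonneg hK0 4)))
  calc _ ≤ ‖∫ ω, cexp (((s * (∑ z ∈ box d n, X z ω - ∫ ω', ∑ z ∈ box d n, X z ω' ∂μ) : ℝ) : ℂ) * I) ∂μ -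
          ((Real.exp (-(s ^ 2 * W / 2)) : ℝ) : ℂ)‖ +
        ‖((Real.exp (-(s ^ 2 * W / 2)) : ℝ) : ℂ) - ((Real.exp (-(σ2 * t ^ 2 / 2)) : ℝ) : ℂ)‖ :=
        norm_sub_le_norm_sub_add_norm_sub _ _ _
    _ ≤ (2 * s ^ 2 * (V - W) + #((box d n).image β) * (|s| ^ 3 * K ^ 3 + s ^ 4 * K ^ 4)) +
        t ^ 2 / 2 * (|V / N - σ2| + (V / N - #(box d ((n - k) / (2 * k + 1))) * Vk / N)) := add_le_add hB hG
    _ ≤ _ := by linarith [hterm1, hterm2]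

/-! ### Newman's Theorem 2 -/

/-- **NEWMAN'S CENTRAL LIMIT THEOREM, characteristic-function form** (1980, Thm. 2): for `d ≥ 1`, a positively associated
probability measure, an increasing measurable field with `|X_z| ≤ M` and covariances `Cov(X_x, X_y) = γ(y − x)`,
`Σ_z γ(z) < ∞`: for every real `t`, `E exp(it(S_n − E S_n)/√|Λ_n|) → exp(−σ²t²/2)`, `σ² = Σ_z γ(z)`, `S_n = Σ_{z∈Λ_n} X_z`.
[cite: Newman1980, Thm. 2] -/
theorem tendsto_charFun_boxSum (hd : 1 ≤ d) (hμ : IsPositivelyAssociated μ) (hXm : ∀ z, Measurable (X z))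
    (hXmono : ∀ z, Monotone (X z)) (hM : 0 ≤ M) (hXb : ∀ z ω, |X z ω| ≤ M) (hcov : ∀ x y, cov[X x, X y; μ] = γ (y - x))
    (hγ : Summable γ) (t : ℝ) :
    Tendsto (fun n : ℕ => ∫ ω, cexp ((((t / Real.sqrt #(box d n)) *
        (∑ z ∈ box d n, X z ω - ∫ ω', ∑ z ∈ box d n, X z ω' ∂μ) : ℝ) : ℂ) * I) ∂μ)
      atTop (𝓝 ((Real.exp (-((∑' z, γ z) * t ^ 2 / 2)) : ℝ) : ℂ)) := by
  have hγ0 : ∀ z, 0 ≤ γ z := covariance_kernel_nonneg hμ hXm hXmono hXb hcov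
  set σ2 : ℝ := ∑' z, γ z with hσ2
  have hσ0 : 0 ≤ σ2 := tsum_nonneg hγ0
  set a : ℕ → ℝ := fun L => (∑ x ∈ box d L, ∑ y ∈ box d L, γ (y - x)) / #(box d L) with ha
  have ha_lim : Tendsto a atTop (𝓝 σ2) := tendsto_sum_sum_box_div_card γ hγ0 hγ
  have ha_le : ∀ L, a L ≤ σ2 := sum_sum_box_div_card_le_tsum γ hγ0 hγ
  -- `|Λ_n| → ∞`, `s_n = t/√|Λ_n| → 0`
  have hN : Tendsto (fun n : ℕ => (#(box d n) : ℝ)) atTop atTop := by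
    have h0 : ∀ n : ℕ, n ≤ #(box d n) := fun n => by
      rw [card_box]; exact (show n ≤ 2 * n + 1 by omega).trans (Nat.le_self_pow (by omega) _)
    exact tendsto_natCast_atTop_atTop.comp (tendsto_atTop_mono h0 tendsto_id)
  have hs : Tendsto (fun n : ℕ => t / Real.sqrt #(box d n)) atTop (𝓝 0) :=
    tendsto_const_nhds.div_atTop (Real.tendsto_sqrt_atTop.comp hN)
  rw [Metric.tendsto_nhds]
  intro ε hε
  -- the budget
  set C : ℝ := 2 * t ^ 2 * (2 + σ2) + t ^ 2 + t ^ 2 / 2 * (3 + σ2) with hC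
  have hCnn : 0 ≤ C := by simp only [hC]; nlinarith [hσ0, sq_nonneg t]
  have hC0 : 0 < C + 1 := by linarith
  set ε₁ : ℝ := ε / (C + 1) with hε₁
  have hε₁0 : 0 < ε₁ := div_pos hε hC0
  -- choose the block size `k`
  obtain ⟨k, hk⟩ := (Metric.tendsto_atTop.1 ha_lim ε₁ hε₁0)
  have hak : |a k - σ2| < ε₁ := by simpa [Real.dist_eq] using hk k le_rfl
  set K : ℝ := 2 * M * #(box d k) with hK
  -- eventual facts in `n`
  have hr := tendsto_card_box_mul_card_box_div d k
  have e1 := (Metric.tendsto_nhds.1 ha_lim) ε₁ hε₁0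
  have e2 := (Metric.tendsto_nhds.1 hr) ε₁ hε₁0
  have hsK : Tendsto (fun n : ℕ => |t / Real.sqrt #(box d n)| * K ^ 3 + (t / Real.sqrt #(box d n)) ^ 2 * K ^ 4)
      atTop (𝓝 0) := by
    have h1 := (continuous_abs.tendsto (0 : ℝ)).comp hs
    have h2 := hs.pow 2
    simpa using (h1.mul_const (K ^ 3)).add (h2.mul_const (K ^ 4))
  have e3 := (Metric.tendsto_nhds.1 hsK) ε₁ hε₁0
  have hsK2 : Tendsto (fun n : ℕ => (t / Real.sqrt #(box d n)) ^ 2 * K ^ 2) atTop (𝓝 0) := by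
    simpa using (hs.pow 2).mul_const (K ^ 2)
  have e4 := (tendsto_order.1 hsK2).2 2 (by norm_num)
  filter_upwards [eventually_ge_atTop k, e1, e2, e3, e4] with n hkn h1 h2 h3 h4
  rw [Real.dist_eq] at h1 h2 h3
  rw [dist_eq_norm]
  have hmain := norm_charFun_boxSum_sub_le hμ hXm hXmono hM hXb hcov hkn t h4.le
  -- abbreviations matching the estimate
  set r : ℝ := (#(box d ((n - k) / (2 * k + 1))) : ℝ) * #(box d k) / #(box d n) with hrdef
  have hkpos : (0 : ℝ) < #(box d k) := card_box_pos d k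
  have hΔ : (∑ x ∈ box d n, ∑ y ∈ box d n, γ (y - x)) / #(box d n) -
      #(box d ((n - k) / (2 * k + 1))) * (∑ x ∈ box d k, ∑ y ∈ box d k, γ (y - x)) / #(box d n) =
        a n - r * a k := by
    simp only [ha, hrdef]
    field_simp
  rw [hΔ] at hmain
  -- `Δ ≤ ε₁ (2 + σ²)`
  have hak0 : 0 ≤ a k := div_nonneg (sum_sum_kernel_nonneg hμ hXm hXmono hXb hcov _ _) (Nat.cast_nonneg _)
  have hΔle : a n - r * a k ≤ ε₁ * (2 + σ2) := by
    have e : a n - r * a k = (a n - σ2) + (σ2 - a k) + (1 - r) * a k := by ring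
    rw [e]
    have i1 : a n - σ2 ≤ ε₁ := (le_abs_self _).trans h1.le
    have i2 : σ2 - a k ≤ ε₁ := by linarith [(neg_abs_le (a k - σ2))]
    have i3 : (1 - r) * a k ≤ ε₁ * σ2 := by
      refine (le_abs_self _).trans ?_
      rw [abs_mul, abs_of_nonneg hak0, abs_sub_comm]
      exact mul_le_mul h2.le (ha_le k) hak0 hε₁0.le
    linarith
  have h3' : |t / Real.sqrt #(box d n)| * K ^ 3 + (t / Real.sqrt #(box d n)) ^ 2 * K ^ 4 < ε₁ := by
    have := (le_abs_self _).trans_lt h3; simpa using this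
  calc _ ≤ 2 * t ^ 2 * (a n - r * a k) + t ^ 2 * (|t / Real.sqrt #(box d n)| * K ^ 3 +
          (t / Real.sqrt #(box d n)) ^ 2 * K ^ 4) + t ^ 2 / 2 * (|a n - σ2| + (a n - r * a k)) := hmain
    _ ≤ 2 * t ^ 2 * (ε₁ * (2 + σ2)) + t ^ 2 * ε₁ + t ^ 2 / 2 * (ε₁ + ε₁ * (2 + σ2)) := by
        gcongr
    _ = ε₁ * C := by simp only [hC]; ring
    _ < ε := by
        rw [hε₁, div_mul_eq_mul_div, div_lt_iff₀ hC0]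
        exact mul_lt_mul_of_pos_left (lt_add_one C) hε

/-- **NEWMAN'S CENTRAL LIMIT THEOREM** (1980, Thm. 2), convergence in distribution: under the hypotheses of
`tendsto_charFun_boxSum`, `(S_n − E S_n)/√|Λ_n| → N(0, σ²)` in distribution, `σ² = Σ_z Cov(X_0, X_z)` — for any random
variable `Y` with law `gaussianReal 0 v`, `v = σ²` (as an `ℝ≥0`; Lévy's continuity theorem). [cite: Newman1980, Thm. 2] -/
theorem tendstoInDistribution_boxSum {Ω' : Type*} {mΩ' : MeasurableSpace Ω'} {P' : Measure Ω'}
    [IsProbabilityMeasure P'] {Y : Ω' → ℝ} (hd : 1 ≤ d) (hμ : IsPositivelyAssociated μ)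
    (hXm : ∀ z, Measurable (X z)) (hXmono : ∀ z, Monotone (X z)) (hM : 0 ≤ M) (hXb : ∀ z ω, |X z ω| ≤ M)
    (hcov : ∀ x y, cov[X x, X y; μ] = γ (y - x)) (hγ : Summable γ) {v : NNReal} (hv' : (v : ℝ) = ∑' z, γ z)
    (hY : HasLaw Y (gaussianReal 0 v) P') :
    TendstoInDistribution (fun (n : ℕ) ω => (Real.sqrt #(box d n))⁻¹ *
        (∑ z ∈ box d n, X z ω - ∫ ω', ∑ z ∈ box d n, X z ω' ∂μ)) atTop Y (fun _ => μ) P' where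
  forall_aemeasurable n := ((measurable_fieldSum hXm (box d n)).sub_const _ |>.const_mul _).aemeasurable
  aemeasurable_limit := hY.aemeasurable
  tendsto := by
    refine ProbabilityMeasure.tendsto_iff_tendsto_charFun.2 fun t => ?_
    rw! [hY.map_eq]
    have hlim := tendsto_charFun_boxSum hd hμ hXm hXmono hM hXb hcov hγ t
    have hgauss : charFun (gaussianReal 0 v) t = ((Real.exp (-((∑' z, γ z) * t ^ 2 / 2)) : ℝ) : ℂ) := by
      rw [charFun_gaussianReal, Complex.ofReal_exp, hv']
      congr 1
      push_cast
      ring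
    simp only [ProbabilityMeasure.coe_mk]
    rw [hgauss]
    refine hlim.congr fun n => ?_
    rw [charFun_apply_real, integral_map (((measurable_fieldSum hXm (box d n)).sub_const _
      |>.const_mul _).aemeasurable) (by fun_prop)]
    refine integral_congr_ae (ae_of_all _ fun ω => ?_)
    push_cast
    ring_nf

end NewmanCLT

end Summit.CriticalPhenomena.PercolationContinuityZ3.Theorems.FK
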